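import Mathlib
import HarnessLib
import Literature.AlgebraicGeometry.Ramification.InertiaNormalSylow
import Summits.ResolutionOfSingularities.ResolutionOfSingularities.Theorems.WildQuotientsWildQuotientResolutionTameMove
import Summits.ResolutionOfSingularities.ResolutionOfSingularities.Theorems.WildQuotientsWildQuotientResolutionTameOrbitCentre

/-!
# The ORBIT TAME MOVE of Phase 0 in every dimension: blow up the union of disjoint conjugate tame inert loci
# (crux `WildQuotients.WildQuotientResolution`, stub `stub_phaseZeroHighDim`)

Crux stmt-ResolutionOfSingularities-15640 (`WildQuotientResolution`), registered stub `stub_phaseZeroHighDim`.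
✓`tameMove` (p819797) blows up the inert locus of a NORMAL tame subgroup. The Batyrev-ordered tame layer
(evidence memo PHASE0-TAME-CENTRE-ORDER.md; ✓`NpcTameCentre` p820512: a tame cyclic subgroup of the inertia group
with fixed locus of codimension ≥ 2 exists at every non-p-closed point) uses NON-normal tame subgroups, whose
`G`-orbit of inert loci is the union over the conjugacy class; ✓`tameOrbitCentre` (p820560) makes this union a
`G`-stable regular centre as soon as the distinct conjugate inert loci are pairwise DISJOINT. This file packages the
corresponding move with all structural clauses of the stub:

**Theorem** (`tameOrbitMove`). For the crux data in any dimension and a finite conjugation-stable family `S ∌ 1` of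
subgroups of order prime to `p` whose inert loci are pairwise disjoint for distinct members, the blow-up
`π : X♯ → X′` of the reduced union `W = ⋃_{K ∈ S} Z_K` with the lifted action is proper, birational, `X♯` integral
and REGULAR, `π` equivariant and a blowing up of `𝓘_W`, `I_x ≤ I_{π x}`, and `X♯` has a `G`-stable affine cover.

[OURS · crux stmt-ResolutionOfSingularities-15640 · helper toward `stub_phaseZeroHighDim` (the orbit form of the
tame move; NOT a proof of the stub); counted 0; AI-level work, weaker than expert review.]
-/

-- single-problem summit: the doubled namespace component `ResolutionOfSingularities` is forced
set_option linter.dupNamespace false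

noncomputable section

namespace Summit.ResolutionOfSingularities.ResolutionOfSingularities.Theorems.WildQuotientResolution.InertLocusStalk

open CategoryTheory AlgebraicGeometry TopologicalSpace IsLocalRing
open Literature.AlgebraicGeometry.Resolution Literature.AlgebraicGeometry.Ramification
open Summit.ResolutionOfSingularities.ResolutionOfSingularities.Theorems.WildQuotientResolution

/-- **The orbit tame move of Phase 0, any dimension** (crux stmt-ResolutionOfSingularities-15640, toward
`stub_phaseZeroHighDim`). Crux data: `k` a field of characteristic `p`, `X₁/k` separated of finite type, `X′`
integral regular, `q : X′ → X₁` finite, `ρ` a faithful action of the finite group `G` over `q`. Let `S` be a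
finite family of subgroups of `G`, stable under conjugation, not containing the trivial subgroup, each of
order prime to `p`, whose inert loci `Z_K = {y | K ≤ I_y}` are pairwise disjoint for distinct `K, K' ∈ S` (for
`S = ∅` the move is the blow-up of the unit ideal, an isomorphism). Then the
blow-up of the reduced union `W = ⋃_{K ∈ S} Z_K` with the lifted action is proper, birational, integral, REGULAR,
equivariant, a blowing up of `𝓘_W`, does not enlarge inertia groups, and carries a `G`-stable affine cover.
[folklore] -/
theorem tameOrbitMove (p : ℕ) (hp : p.Prime) (k : Type) [Field k] [CharP k p]
    (X' X₁ : Scheme.{0}) (f : X₁ ⟶ Spec (.of k)) (q : X' ⟶ X₁) (G : Type) [Group G] [Finite G]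
    (ρ : G →* Aut X') (hfaith : Function.Injective ρ)
    [IsSeparated f] [LocallyOfFiniteType f] [QuasiCompact f] [IsIntegral X']
    (hreg : Scheme.IsRegular X') [IsFinite q] (hρ : ∀ g : G, (ρ g).hom ≫ q = q)
    (S : Finset (Subgroup G)) (hS : ∀ (g : G), ∀ K ∈ S, K.map (MulAut.conj g).toMonoidHom ∈ S)
    (hS1 : ⊥ ∉ S) (hcop : ∀ K ∈ S, (Nat.card K).Coprime p)
    (hdisj : ∀ K ∈ S, ∀ K' ∈ S, K ≠ K' →
      Disjoint {y : X' | K ≤ inertiaSubgroup ρ y} {y : X' | K' ≤ inertiaSubgroup ρ y}) :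
    ∃ (hW : IsClosed (⋃ K ∈ S, {y : X' | K ≤ inertiaSubgroup ρ y}))
      (Xs : Scheme.{0}) (π : Xs ⟶ X') (ρs : G →* Aut Xs), IsProper π ∧ IsBirational π ∧
      IsIntegral Xs ∧ Scheme.IsRegular Xs ∧ (∀ g : G, (ρs g).hom ≫ π = π ≫ (ρ g).hom) ∧
      IsBlowup π (Scheme.IdealSheafData.vanishingIdeal ⟨⋃ K ∈ S, {y : X' | K ≤ inertiaSubgroup ρ y}, hW⟩) ∧
      (∀ x : Xs, inertiaSubgroup ρs x ≤ inertiaSubgroup ρ (π.base x)) ∧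
      ∀ x : Xs, ∃ U : Xs.Opens, IsAffineOpen U ∧ x ∈ U ∧ ∀ g : G, (ρs g).hom ⁻¹ᵁ U = U := by
  classical
  haveI : Fact p.Prime := ⟨hp⟩
  haveI : IsLocallyNoetherian X' := LocallyOfFiniteType.isLocallyNoetherian (q ≫ f)
  haveI : X'.IsSeparated := Scheme.isSeparated_of_isSeparated_over (q ≫ f)
  have hZ : ∀ K : Subgroup G, IsClosed {y : X' | K ≤ inertiaSubgroup ρ y} := fun K =>
    PointMoveNoNpcCurves.isClosed_setOf_le_inertia q ρ hρ K
  -- residue characteristics of `X′`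
  have hcharX : ∀ z : X', CharP (ResidueField (X'.presheaf.stalk z)) p := fun z =>
    (((IsLocalRing.residue (X'.presheaf.stalk z)).comp ((X'.presheaf.germ ⊤ z trivial).hom.comp
      (((q ≫ f).appTop).hom.comp (Scheme.ΓSpecIso (.of k)).inv.hom))).charP_iff_charP p).mp
      inferInstance
  -- each member's reduced inert locus is regular
  have hregK : ∀ K ∈ S, Scheme.IsRegular
      (Scheme.IdealSheafData.vanishingIdeal ⟨{y : X' | K ≤ inertiaSubgroup ρ y}, hZ K⟩).subscheme := by
    intro K hK
    haveI : Finite K := inferInstance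
    exact isRegular_subscheme_vanishingIdeal_inertLocus_of_coprime ρ K p (hZ K) (fun x _ => hreg x)
      (fun x _ => hcharX x) (hcop K hK)
  -- the orbit centre
  obtain ⟨hW, hcomap, hregW, -⟩ := tameOrbitCentre ρ S hS hZ hdisj hregK
  set 𝒥 : X'.IdealSheafData :=
    Scheme.IdealSheafData.vanishingIdeal ⟨⋃ K ∈ S, {y : X' | K ≤ inertiaSubgroup ρ y}, hW⟩ with h𝒥def
  -- non-zero: otherwise `W = X′` contains the generic point, whose inertia group is trivial, so `1 ∈ S`
  have hJne : 𝒥 ≠ ⊥ := by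
    intro h
    have hsupp : ((Scheme.IdealSheafData.vanishingIdeal
        ⟨⋃ K ∈ S, {y : X' | K ≤ inertiaSubgroup ρ y}, hW⟩).support : Set X') = Set.univ := by
      rw [← h𝒥def, h, Scheme.IdealSheafData.support_bot]
      rfl
    rw [Scheme.IdealSheafData.coe_support_vanishingIdeal] at hsupp
    have hsupp' : (⋃ K ∈ S, {y : X' | K ≤ inertiaSubgroup ρ y}) = Set.univ := hsupp
    have hη : genericPoint X' ∈ ⋃ K ∈ S, {y : X' | K ≤ inertiaSubgroup ρ y} := by
      rw [hsupp']
      exact Set.mem_univ _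
    obtain ⟨K, hK, hKη⟩ := Set.mem_iUnion₂.mp hη
    have hKη' : K ≤ inertiaSubgroup ρ (genericPoint X') := hKη
    rw [PhaseZeroDimOne.inertiaSubgroup_genericPoint_eq_bot q ρ hρ hfaith, le_bot_iff] at hKη'
    exact hS1 (hKη' ▸ hK)
  -- the blow-up and the lifted action
  obtain ⟨Xs, π, hπ⟩ := exists_isBlowup X' 𝒥
  let ρs : G →* Aut Xs := hπ.liftAction ρ hcomap
  have hequiv : ∀ g : G, (ρs g).hom ≫ π = π ≫ (ρ g).hom := hπ.liftAction_hom_comp ρ hcomap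
  haveI hXs : IsIntegral Xs := hπ.isIntegral hJne
  haveI hπp : IsProper π := hπ.isProper
  have hbir : IsBirational π := hπ.isBirational' hJne
  have hXsreg : Scheme.IsRegular Xs := hπ.isRegular_of_isRegular_subscheme hreg hregW
  refine ⟨hW, Xs, π, ρs, hπp, hbir, hXs, hXsreg, hequiv, hπ, fun x => ?_, fun x => ?_⟩
  · exact InertiaLe.stub_inertia_le ρs ρ π hequiv x
  · exact StableAffineCoverBlowup.stub_stableAffineCoverBlowup q ρ hρ hπ ρs hequiv x

end Summit.ResolutionOfSingularities.ResolutionOfSingularities.Theorems.WildQuotientResolution.InertLocusStalk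

end
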